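import Literature.NumberTheory.EllipticCurves.Kato2004.IwasawaH1TowerLimitProofs
import Literature.NumberTheory.EllipticCurves.CyclotomicLayerTatePairing
import Literature.NumberTheory.EllipticCurves.Sprung2012.ColemanMaps
import Summits.BirchSwinnertonDyer.Rank1Residual.Additive.StrictSignedSelmerInftyLocal
import HarnessLib

/-!
# Route `ThetaPartnerAtTwo` (TP2), crux K2R0P♭ `SignedMainConjectureCMTwoRankZeroOfPubOfFlat` (stmt-BirchSwinnertonDyer-26471;
# derived node K2r0P stmt-BirchSwinnertonDyer-24945), line `rankzero` v19, stub `stub_poitouTateDeepTwoGen` = (S_PT) — brick B9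
# (ASSEMBLY) of the kernel route `Cruxes/SignedMainConjectureCMTwoRankZeroOfPub/PT-DEEP-HALF-DESIGN-w2g4.md` §2 (e), §3:
# **the Λ-adic Poitou–Tate deep half from LEVELWISE solutions** — finite admissible sets of finite-level classes with the
# prescribed local pairing values at every `(n, k)` assemble (Kőnig + Rubin B.2.3 + separatedness, bricks B7/B8) into ONE
# element of `𝐇¹_Γ(T_pW)` whose layer pairings are `p^m · z`

HONEST FRAMING (cell `pub/bsd-wall`, W-ALL row 1; lead prover `bsd-wall-tp2-p2` g10, `--supports` only). THEOREMS ONLY (no definition,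
no named fact, no instance, no `sorry`); closes no item; BSD is NOT proved by any of this.

## What is here (the INTERFACE the other bricks feed; every hypothesis is named after its brick)

`poitouTateDeep_of_levelwise`: for an elliptic `W/ℚ`, a prime `p`, a `ℤ_p`-extension `κ`, a place `v`, the pinned Iwasawa cohomology
`I : Kato2004.IwasawaH1Data W p κ γ`, a sign `ε`, THE `T_pW`-adic layer pairings `pair` (pinned by their residues (P3) to
`CyclotomicLayer.tatePairingPk`, hence to `CyclotomicLayer.layerPairingMod (p^k)` of THE Weil pairings `CyclotomicLayer.weilTowerPk`),
a functional `z : E(ℚ_∞·ℚ_v) →+ ℤ_p` and exponents `m₀, e`: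
* (R) = B2/B6: "admissible" sets `R n k ⊆ H¹(Γ_n, W[p^k])` (e.g. classes unramified outside a finite `S`), FINITE, stable under
  `p_*` (`WeierstrassCurve.reduceTorsionH1`) and under the trace maps (`Kato2004.layerCores`);
* (E) = B1+B4+B5 (Milne I 4.10 (b) at each finite level, read through Shapiro B3): for every `(n, k)` SOME admissible class `c` has
  `⟨c, Q⟩_{n,p^k} = p^{m₀} z(Q) mod p^k` for all `Q ∈ E^ε(ℚ_n·ℚ_v)`;
* (C) = the level compatibility of the finite-coefficient layer pairings in `k` (`hpk`) and the projection formula in `n` (`hpn`)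
  (K3 column: `SignedKatoOffTwo.LayerPairing.layerPairingPk_succ_compat` / `layerPairingMod_layerCores` pattern);
* (I) = B6: any `T_pW`-adic class at layer `n` all of whose reductions are admissible becomes integral (`Kato2004.integralH1`) after
  multiplication by `p^e` (e.g. `e = 2` at `p = 2` for CM curves: `4 · H¹(ℚ_{n,w}, T₂A) = 0` at the additive places `w`);
THEN `∃ x ∈ 𝐇¹_Γ(T_pW)` (`I.H`) with `p^{m₀+e} · z(Q) = pair_n(proj_n x)(Q)` for every `n` and every `Q ∈ E^ε(ℚ_n·ℚ_v)` — the conclusion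
of (PT♭)_layer with `m = m₀ + e`.  Proof: the solution sets `S n k = {c ∈ R n k | pairing identity}` are finite, non-empty and stable
under `p_*`/`Cor` ((C), `E^ε_n ⊆ E^ε_{n+1}`); Kőnig (`Kato2004.exists_compatible_of_finite_nonempty`) gives a doubly compatible family,
Rubin B.2.3 + separatedness (`Kato2004.exists_normCompatible_of_compatible`) a trace-compatible `T_pW`-adic family `y`, (I) makes
`p^e y` an element `x` of `I.H` (`proj_surjective`), and the residues of `pair_n(y_n)(Q)` are the prescribed ones for every `k`
(`PadicInt.ext_of_toZModPow`).

References: [Kobayashi2003] (7.17)–(7.20), Thm. 7.3 (ii) (pp. 12–13), (8.23); [Rubin2000] App. B Prop. B.2.3, §B.3; [MilneADT2006] I Thm. 4.10;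
[Kato2004Asterisque] §8.2, §12.2, §17.13; [PerrinRiou1994Invent] §3.6.1.
-/

set_option autoImplicit false
-- the Theorems namespace of this sub repeats the summit name by design (D-0017 nested layout)
set_option linter.dupNamespace false

noncomputable section

open scoped Classical

namespace Summit.BirchSwinnertonDyer.BirchSwinnertonDyer.Theorems

namespace SignedLowerOffTwo.PTDeep

open NumberField IsDedekindDomain Field WeierstrassCurve
  Literature.NumberTheory.EllipticCurves Literature.NumberTheory.EllipticCurves.Kobayashi2003
  Literature.NumberTheory.EllipticCurves.Sprung2012 Literature.NumberTheory.GaloisRepresentations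
  Literature.NumberTheory.EllipticCurves.Kato2004 Literature.NumberTheory.EllipticCurves.Kato2004.EulerSystemValues ZpExtension

variable (W : WeierstrassCurve ℚ) [W.IsElliptic] {p : ℕ} [Fact p.Prime] (κ : ZpExtension ℚ p) (v : HeightOneSpectrum (𝓞 ℚ))
  [ContinuousSMul ℤ_[p] (W.tateModule p)] {γ : absoluteGaloisGroup ℚ} (I : Kato2004.IwasawaH1Data W p κ γ) (ε : ℤˣ)

/-- **(PT♭)_layer from levelwise solutions (brick B9 = assembly of B1–B8).**  See the module docstring for the reading of the
hypotheses (R) `hRfin/hRk/hRn`, (E) `hex`, (C) `hpk/hpn`, (I) `hint`.  Conclusion: ONE element `x ∈ 𝐇¹_Γ(T_pW)` with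
`p^{m₀+e} · z(Q) = pair_n(proj_n x)(Q)` for all layers `n` and all `Q ∈ E^ε(ℚ_n·ℚ_v)`.
[cite: Kobayashi2003, (7.17)–(7.20) and Thm. 7.3 (ii) (pp. 12–13)] [cite: Rubin2000, App. B Prop. B.2.3 and §B.3]
[cite: MilneADT2006, Ch. I Thm. 4.10] [cite: Kato2004Asterisque, §8.2 (p. 181) and §12.2 (p. 220)] -/
theorem poitouTateDeep_of_levelwise
    (pair : ∀ n : ℕ, H1 (tateRep W p) (κ.layerSubgroup n) →ₗ[ℤ_[p]]
      (localLayerPointsOfEmb κ (closureEmb (K := ℚ) (v.adicCompletion ℚ)) W n →+ ℤ_[p]))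
    (hP3 : ∀ (n k : ℕ) (x : H1 (tateRep W p) (κ.layerSubgroup n))
      (Q : localLayerPointsOfEmb κ (closureEmb (K := ℚ) (v.adicCompletion ℚ)) W n),
      PadicInt.toZModPow k (pair n x Q) = CyclotomicLayer.tatePairingPk W κ v n k x Q)
    (z : localTowerPointsOfEmb κ (closureEmb (K := ℚ) (v.adicCompletion ℚ)) W →+ ℤ_[p]) (m₀ e : ℕ)
    -- (R) admissible classes: finite, stable under `p_*` and under the trace maps
    (R : ∀ n k : ℕ, Set (W.torsionH1Over ((p : ℤ) ^ k) (κ.layerSubgroup n)))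
    (hRfin : ∀ n k, (R n k).Finite)
    (hRk : ∀ n k, ∀ c ∈ R n (k + 1), W.reduceTorsionH1 p k (κ.layerSubgroup n) c ∈ R n k)
    (hRn : ∀ n k, ∀ c ∈ R (n + 1) k, layerCores (W.torsionGaloisModule ((p : ℤ) ^ k)) κ n c ∈ R n k)
    -- (E) levelwise existence (finite-level Poitou–Tate)
    (hex : ∀ n k, ∃ c ∈ R n k, ∀ (Q : localPoints W (v.adicCompletion ℚ))
      (hQ : Q ∈ signedLocalPointsOfEmb κ (closureEmb (K := ℚ) (v.adicCompletion ℚ)) W ε n),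
      CyclotomicLayer.layerPairingMod W (p ^ k) (CyclotomicLayer.weilTowerPk W k) (CyclotomicLayer.weilTowerPk_pow W k)
          (CyclotomicLayer.weilTowerPk_add_left W k) (CyclotomicLayer.weilTowerPk_add_right W k)
          (CyclotomicLayer.weilTowerPk_smul W k) κ v n c
          ⟨Q, signedLocalPointsOfEmb_le κ _ W ε n hQ⟩ =
        PadicInt.toZModPow k ((p : ℤ_[p]) ^ m₀ *
          z ⟨Q, localLayerPointsOfEmb_le_localTowerPointsOfEmb κ _ W n (signedLocalPointsOfEmb_le κ _ W ε n hQ)⟩))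
    -- (C) level compatibility in `k` and projection formula in `n` of the finite-coefficient layer pairings
    (hpk : ∀ (n k : ℕ) (c : W.torsionH1Over ((p : ℤ) ^ (k + 1)) (κ.layerSubgroup n))
      (Q : localLayerPointsOfEmb κ (closureEmb (K := ℚ) (v.adicCompletion ℚ)) W n),
      (ZMod.cast (CyclotomicLayer.layerPairingMod W (p ^ (k + 1)) (CyclotomicLayer.weilTowerPk W (k + 1))
          (CyclotomicLayer.weilTowerPk_pow W (k + 1)) (CyclotomicLayer.weilTowerPk_add_left W (k + 1))
          (CyclotomicLayer.weilTowerPk_add_right W (k + 1)) (CyclotomicLayer.weilTowerPk_smul W (k + 1)) κ v n c Q) :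
          ZMod (p ^ k)) =
        CyclotomicLayer.layerPairingMod W (p ^ k) (CyclotomicLayer.weilTowerPk W k) (CyclotomicLayer.weilTowerPk_pow W k)
          (CyclotomicLayer.weilTowerPk_add_left W k) (CyclotomicLayer.weilTowerPk_add_right W k)
          (CyclotomicLayer.weilTowerPk_smul W k) κ v n (W.reduceTorsionH1 p k (κ.layerSubgroup n) c) Q)
    (hpn : ∀ (n k : ℕ) (c : W.torsionH1Over ((p : ℤ) ^ k) (κ.layerSubgroup (n + 1)))
      (Q : localPoints W (v.adicCompletion ℚ)) (hQ : Q ∈ localLayerPointsOfEmb κ (closureEmb (K := ℚ) (v.adicCompletion ℚ)) W n),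
      CyclotomicLayer.layerPairingMod W (p ^ k) (CyclotomicLayer.weilTowerPk W k) (CyclotomicLayer.weilTowerPk_pow W k)
          (CyclotomicLayer.weilTowerPk_add_left W k) (CyclotomicLayer.weilTowerPk_add_right W k)
          (CyclotomicLayer.weilTowerPk_smul W k) κ v n (layerCores (W.torsionGaloisModule ((p : ℤ) ^ k)) κ n c) ⟨Q, hQ⟩ =
        CyclotomicLayer.layerPairingMod W (p ^ k) (CyclotomicLayer.weilTowerPk W k) (CyclotomicLayer.weilTowerPk_pow W k)
          (CyclotomicLayer.weilTowerPk_add_left W k) (CyclotomicLayer.weilTowerPk_add_right W k)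
          (CyclotomicLayer.weilTowerPk_smul W k) κ v (n + 1) c
          ⟨Q, localLayerPointsOfEmb_mono κ (closureEmb (K := ℚ) (v.adicCompletion ℚ)) W (Nat.le_succ n) hQ⟩)
    -- (I) integrality after multiplication by `p^e`
    (hint : ∀ (n : ℕ) (y : H1 (tateRep W p) (κ.layerSubgroup n)),
      (∀ k, reduceH1Pk W p k (κ.layerSubgroup n) y ∈ R n k) →
      ((p : ℤ_[p]) ^ e) • y ∈ integralH1 (tateRep W p) p (κ.layerSubgroup n)) :
    ∃ x : I.H, ∀ (n : ℕ) (Q : localPoints W (v.adicCompletion ℚ))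
      (hQ : Q ∈ signedLocalPointsOfEmb κ (closureEmb (K := ℚ) (v.adicCompletion ℚ)) W ε n),
      (p : ℤ_[p]) ^ (m₀ + e) *
          z ⟨Q, localLayerPointsOfEmb_le_localTowerPointsOfEmb κ _ W n (signedLocalPointsOfEmb_le κ _ W ε n hQ)⟩ =
        pair n (I.proj n x) ⟨Q, signedLocalPointsOfEmb_le κ _ W ε n hQ⟩ := by
  classical
  -- the solution sets
  let S : ∀ n k : ℕ, Set (W.torsionH1Over ((p : ℤ) ^ k) (κ.layerSubgroup n)) := fun n k ↦
    {c | c ∈ R n k ∧ ∀ (Q : localPoints W (v.adicCompletion ℚ))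
      (hQ : Q ∈ signedLocalPointsOfEmb κ (closureEmb (K := ℚ) (v.adicCompletion ℚ)) W ε n),
      CyclotomicLayer.layerPairingMod W (p ^ k) (CyclotomicLayer.weilTowerPk W k) (CyclotomicLayer.weilTowerPk_pow W k)
          (CyclotomicLayer.weilTowerPk_add_left W k) (CyclotomicLayer.weilTowerPk_add_right W k)
          (CyclotomicLayer.weilTowerPk_smul W k) κ v n c
          ⟨Q, signedLocalPointsOfEmb_le κ _ W ε n hQ⟩ =
        PadicInt.toZModPow k ((p : ℤ_[p]) ^ m₀ *
          z ⟨Q, localLayerPointsOfEmb_le_localTowerPointsOfEmb κ _ W n (signedLocalPointsOfEmb_le κ _ W ε n hQ)⟩)}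
  have hSfin : ∀ n k, (S n k).Finite := fun n k ↦ (hRfin n k).subset fun c hc ↦ hc.1
  have hSne : ∀ j, (S j j).Nonempty := fun j ↦ by
    obtain ⟨c, hcR, hc⟩ := hex j j
    exact ⟨c, hcR, hc⟩
  have hSk : ∀ n k, ∀ c ∈ S n (k + 1), W.reduceTorsionH1 p k (κ.layerSubgroup n) c ∈ S n k := by
    rintro n k c ⟨hcR, hc⟩
    refine ⟨hRk n k c hcR, fun Q hQ ↦ ?_⟩
    rw [← hpk, hc Q hQ, PadicInt.cast_toZModPow k (k + 1) (Nat.le_succ k)]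
  have hSn : ∀ n k, ∀ c ∈ S (n + 1) k,
      layerCores (W.torsionGaloisModule ((p : ℤ) ^ k)) κ n c ∈ S n k := by
    rintro n k c ⟨hcR, hc⟩
    refine ⟨hRn n k c hcR, fun Q hQ ↦ ?_⟩
    rw [hpn n k c Q (signedLocalPointsOfEmb_le κ _ W ε n hQ)]
    exact hc Q (Summit.BirchSwinnertonDyer.Rank1Residual.Additive.signedLocalPointsOfEmb_mono κ
      (closureEmb (K := ℚ) (v.adicCompletion ℚ)) W ε (Nat.le_succ n) hQ)
  -- Kőnig, then Rubin B.2.3 + separatedness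
  obtain ⟨c, hcS, hck, hcn⟩ := exists_compatible_of_finite_nonempty W p κ S hSfin hSne hSk hSn
  obtain ⟨y, hy, hcor⟩ := exists_normCompatible_of_compatible W p κ c hck hcn
  -- integrality of `p^e • y` and the element of `𝐇¹`
  have hyint : ∀ n, ((p : ℤ_[p]) ^ e) • y n ∈ integralH1 (tateRep W p) p (κ.layerSubgroup n) := fun n ↦
    hint n (y n) fun k ↦ by rw [hy]; exact (hcS n k).1
  have hnc : IsNormCompatible (tateRep W p) κ (fun n ↦ ((p : ℤ_[p]) ^ e) • y n) :=
    ⟨hyint, fun n ↦ by rw [map_smul, hcor]⟩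
  obtain ⟨x, hx⟩ := I.proj_surjective _ hnc
  refine ⟨x, fun n Q hQ ↦ ?_⟩
  -- the residues of `pair_n(y_n)(Q)` are the prescribed ones
  have key : pair n (y n) ⟨Q, signedLocalPointsOfEmb_le κ _ W ε n hQ⟩ =
      (p : ℤ_[p]) ^ m₀ *
        z ⟨Q, localLayerPointsOfEmb_le_localTowerPointsOfEmb κ _ W n (signedLocalPointsOfEmb_le κ _ W ε n hQ)⟩ := by
    refine PadicInt.ext_of_toZModPow.mp fun k ↦ ?_
    rw [hP3, CyclotomicLayer.tatePairingPk_eq, CyclotomicLayer.layerPairingPk_apply]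
    change CyclotomicLayer.layerPairingMod W (p ^ k) (CyclotomicLayer.weilTowerPk W k) (CyclotomicLayer.weilTowerPk_pow W k)
        (CyclotomicLayer.weilTowerPk_add_left W k) (CyclotomicLayer.weilTowerPk_add_right W k)
        (CyclotomicLayer.weilTowerPk_smul W k) κ v n (reduceH1Pk W p k (κ.layerSubgroup n) (y n))
        ⟨Q, signedLocalPointsOfEmb_le κ _ W ε n hQ⟩ = _
    rw [hy]
    exact (hcS n k).2 Q hQ
  rw [hx, map_smul, AddMonoidHom.smul_apply, key, smul_eq_mul, pow_add]
  ring

end SignedLowerOffTwo.PTDeep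

end Summit.BirchSwinnertonDyer.BirchSwinnertonDyer.Theorems

end
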